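import Summits.BirchSwinnertonDyer.Rank1Residual.GaloisImage.CanonicalKolyvaginDatumAdmissible
import Summits.BirchSwinnertonDyer.Rank1Residual.GaloisImage.FiniteSingularComparisonLocal
import Mathlib.LinearAlgebra.Charpoly.ToMatrix
import HarnessLib

/-!
# The finite–singular comparison OPERATOR under a change of level `N₂ → N₁`, and cocycles on the
# `η`-fibre of inertia (cell `b2b-bsdres`, team n1011, seat p15 GEN 4, OWNERS row T-INJ-DEV, file F-B1a;
# skeleton `cells/n1011/skel/T-INJ-DEV.md`)

HONEST FRAMING (cell `b2b-bsdres`, run/shared/lean/b2b/bsd-rank1-residual/, verbatim in every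
file): the goal of the cell is to DELETE the COMBINATION-SHAPED residual classes of the
Birch–Swinnerton-Dyer formula for ALL analytic-rank `≤ 1` elliptic curves over `ℚ` — "full BSD
formula for every rank `≤ 1` curve in class `C`" assembled STRICTLY from published theorems — so
that the rank-`≤ 1` remainder becomes exactly the CONSTRUCTION-SHAPED classes, which are TYPED
(missing-input `Prop`s), NOT attempted. This is not "finishing BSD". Team n1011 (N10 / N11, the
additive block X4 ∧ `p = 3`): research route on the CONSTRUCTION-SHAPED class X4; TOOL theorems of
local Galois cohomology and linear algebra; no class theorem; nothing is booked; no label and no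
RESIDUAL-MAP mark is moved. Theorems only: no definition, no named fact, no `sorry`.

## What and why

The dévissage of file F-A (`KolyvaginInjectivityDevissage`) transports Kolyvagin systems along a
reduction `red : M → N` and lifts them along an inclusion `incl : N → M` (intended `M = E[p²]`,
`N = E[p]`).  Its finite–singular hypotheses `hfsπ` / `hfsi` say that the comparison maps
`φ^{fs}_𝔮` of the two Kolyvagin data are compatible with `red_*` / `incl_*` on unramified classes.
This file proves that compatibility when BOTH data carry THE CANONICAL comparison maps (Rubin
Def. 1.9.6 in Kim's generator-fixed form, the tree's `HasCanonicalComparison`) with the SAME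
primitive roots `η`, at levels `N₂` (on `M`) and `N₁ ∣ N₂` (on `N`):

* §1 `forall_absInertia_apply_eq_zero_of_fibre` — a cocycle of an UNRAMIFIED module that vanishes on
  the inertia elements `τ` with `χ(τ) = η` (`η` a generator hit by inertia) vanishes on the whole
  inertia group ("the singular part is read off at one `σ_η`");
* §2 the comparison operator under a semilinear change of coefficients: if `g : M → N` is additive,
  `Γ`-equivariant, `ℤ/N₂ → ℤ/N₁`-semilinear and carries a basis to a basis, then
  `charpoly(φ | N) = charpoly(φ | M) mod N₁` (`charpoly_zmodEnd_eq_map`), hence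
  `P_N = P_M mod N₁`, `Q_N = Q_M mod N₁` and **`g ∘ Q_M(φ⁻¹) = Q_N(φ⁻¹) ∘ g`**
  (`apply_comparisonOp_eq`); and for an equivariant `i : N → M` on which the `ℤ/N₂`-action factors
  through `ℤ/N₁`, **`Q_M(φ⁻¹) ∘ i = i ∘ Q_N(φ⁻¹)`** (`comparisonOp_apply_eq_of_incl`);
* the `ℤ/N₂ → ℤ/N₁`-semilinearity of ANY additive map between a `ℤ/N₂`-module and a `ℤ/N₁`-module
  (`map_zmod_smul_eq_castHom_smul`, `zmod_smul_map_eq_map_castHom_smul`) — both scalar actions are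
  the `ℤ`-action.
The sibling `CanonicalComparisonLevelChange.lean` (F-B1b) turns this into the transport / reflection
of THE CANONICAL comparison maps (`HasCanonicalComparison`) over `ℚ` — the hypotheses `hfsπ`, `hfsi`
of `KSDevissage.apply_eq_zero_of_apply_eq_zero_of_devissage`.

References: K. Rubin, PCMI 18 (2011) Def. 1.9.6, Prop. 1.4.13, Prop. 1.9.5 [Rubin2011]; B. Mazur,
K. Rubin, Mem. AMS 799 (2004) Def. 1.2.2, Lemma 1.2.3; C.-H. Kim, AJM 148 (2026) §2.1.2, §2.2.2
[Kim2022StructureSelmer]; J.-P. Serre, *Local Fields* IV §4 Prop. 17.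
-/

noncomputable section

open Field Polynomial Module
open Literature.NumberTheory.GaloisRepresentations
open Literature.NumberTheory.GaloisRepresentations.DiscreteGaloisModule
open Literature.NumberTheory.GaloisCohomology
open scoped ContRepresentation Polynomial NumberField

universe u

namespace Summit.BirchSwinnertonDyer.Rank1Residual.GaloisImage.KSDevissage

/-! ### §1 A cocycle vanishing on the `η`-fibre of inertia vanishes on inertia -/

section Fibre

variable {F : Type u} [Field F] [ValuativeRel F] [TopologicalSpace F] [IsNonarchimedeanLocalField F]
variable {M : Type u} [AddCommGroup M] [TopologicalSpace M] [DiscreteTopology M]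
variable (ρ : DiscreteGaloisModule F M)

/-- **A crossed homomorphism of an unramified module vanishing on the `η`-fibre of inertia vanishes
on inertia.**  Let `I_F` act trivially on `M`, `χ : Γ_F → G` a homomorphism, `η ∈ G` with
`⟨η⟩ = G` and `χ(τ₀) = η` for some `τ₀ ∈ I_F` (the mod `ℓ` cyclotomic character and a primitive
root, Serre LF IV §4 Prop. 17).  If a continuous crossed homomorphism `c` has `c(τ) = 0` for every
`τ ∈ I_F` with `χ(τ) = η`, then `c` vanishes on `I_F` (on `I_F`, `c` is a homomorphism; it kills `τ₀`
and `I_F ∩ ker χ`, which generate `I_F` modulo nothing: `τ = τ₀^j · (τ₀^{-j} τ)`).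
[cite: Rubin2011, Prop. 1.9.5 (1)–(2) (p. 14)] [cite: SerreLocalFields1979, IV §4 Prop. 17] -/
theorem forall_absInertia_apply_eq_zero_of_fibre (hI : ∀ τ ∈ absInertia F, ρ τ = 1)
    {G : Type*} [Group G] (χ : absoluteGaloisGroup F →* G) {η : G}
    (hgen : Subgroup.zpowers η = ⊤) (hτ₀ : ∃ τ₀ ∈ absInertia F, χ τ₀ = η)
    (c : contOneCocycles ρ.toTopRep) (hc : ∀ τ ∈ absInertia F, χ τ = η → c.1 τ = 0) :
    ∀ τ ∈ absInertia F, c.1 τ = 0 := by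
  obtain ⟨τ₀, hτ₀I, hτ₀η⟩ := hτ₀
  have hcoc : ∀ a b, c.1 (a * b) = c.1 a + ρ a (c.1 b) := fun a b => c.2 a b
  have h1 : c.1 1 = 0 := contOneCocycles.apply_one c
  -- the subgroup `{g ∈ I_F | c g = 0}` of `Γ_F`
  let U : Subgroup (absoluteGaloisGroup F) :=
    { carrier := {g | g ∈ absInertia F ∧ c.1 g = 0}
      mul_mem' := fun {a b} ha hb => by
        refine ⟨mul_mem ha.1 hb.1, ?_⟩
        rw [hcoc, ha.2, hb.2, map_zero, add_zero]
      one_mem' := ⟨one_mem _, h1⟩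
      inv_mem' := fun {a} ha => by
        refine ⟨inv_mem ha.1, ?_⟩
        have h := hcoc a⁻¹ a
        rw [inv_mul_cancel, h1, ha.2, map_zero, add_zero] at h
        exact h.symm }
  have hmemU : ∀ g, g ∈ U ↔ g ∈ absInertia F ∧ c.1 g = 0 := fun g => Iff.rfl
  have hτ₀U : τ₀ ∈ U := (hmemU τ₀).mpr ⟨hτ₀I, hc τ₀ hτ₀I hτ₀η⟩
  -- kernel elements of `χ` inside inertia are killed
  have hker : ∀ k ∈ absInertia F, χ k = 1 → c.1 k = 0 := by
    intro k hk hχk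
    have h := hc (τ₀ * k) (mul_mem hτ₀I hk) (by rw [map_mul, hτ₀η, hχk, mul_one])
    rw [hcoc, hc τ₀ hτ₀I hτ₀η, zero_add, hI τ₀ hτ₀I, Module.End.one_apply] at h
    exact h
  intro τ hτ
  have hχτ : χ τ ∈ Subgroup.zpowers η := by rw [hgen]; exact Subgroup.mem_top _
  obtain ⟨j, hj⟩ := Subgroup.mem_zpowers_iff.mp hχτ
  -- `τ = τ₀^j · k` with `k ∈ I_F ∩ ker χ`
  set k : absoluteGaloisGroup F := (τ₀ ^ j)⁻¹ * τ with hk_def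
  have hkI : k ∈ absInertia F := mul_mem (inv_mem (Subgroup.zpow_mem _ hτ₀I j)) hτ
  have hχk : χ k = 1 := by
    rw [hk_def, map_mul, map_inv, map_zpow, hτ₀η, hj, inv_mul_cancel]
  have hτeq : τ = τ₀ ^ j * k := by rw [hk_def, mul_inv_cancel_left]
  have hpow : τ₀ ^ j ∈ U := Subgroup.zpow_mem U hτ₀U j
  rw [hτeq, hcoc, ((hmemU _).mp hpow).2, zero_add, hker k hkI hχk, map_zero]

end Fibre

/-! ### §2 The comparison operator under a semilinear change of coefficients -/

section CharpolyMap

variable {R S : Type*} [CommRing R] [CommRing S] (f : R →+* S)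
variable {M N : Type*} [AddCommGroup M] [Module R M] [AddCommGroup N] [Module S N]
variable {ι : Type*} [Fintype ι] [DecidableEq ι]

/-- **Matrices under a semilinear change of coefficients.**  If `g : M → N` is additive and
`f`-semilinear (`g (r • m) = f r • g m`) and carries the basis `b` of `M` to the basis `b′` of `N`,
and `g ∘ φ = ψ ∘ g`, then the matrix of `ψ` in `b′` is the matrix of `φ` in `b` reduced by `f`.
[folklore] -/
theorem toMatrix_eq_map_of_semilinear (b : Basis ι R M) (b' : Basis ι S N) (g : M →+ N)
    (hg : ∀ (r : R) (m : M), g (r • m) = f r • g m) (hb : ∀ i, g (b i) = b' i)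
    (φ : M →ₗ[R] M) (ψ : N →ₗ[S] N) (hφψ : ∀ m, g (φ m) = ψ (g m)) :
    LinearMap.toMatrix b' b' ψ = (LinearMap.toMatrix b b φ).map f := by
  ext i j
  rw [Matrix.map_apply, LinearMap.toMatrix_apply, LinearMap.toMatrix_apply]
  have h1 : ψ (b' j) = ∑ k, f (b.repr (φ (b j)) k) • b' k := by
    have hx := b.sum_repr (φ (b j))
    rw [← hb j, ← hφψ]
    conv_lhs => rw [← hx]
    rw [map_sum]
    refine Finset.sum_congr rfl fun k _ => ?_
    rw [hg, hb]
  rw [h1, b'.repr_sum_self]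

variable [Module.Free R M] [Module.Finite R M] [Module.Free S N] [Module.Finite S N]

/-- **Characteristic polynomials under a semilinear change of coefficients**:
`charpoly ψ = (charpoly φ) reduced by `f``. [folklore] -/
theorem charpoly_eq_map_of_semilinear (b : Basis ι R M) (b' : Basis ι S N) (g : M →+ N)
    (hg : ∀ (r : R) (m : M), g (r • m) = f r • g m) (hb : ∀ i, g (b i) = b' i)
    (φ : M →ₗ[R] M) (ψ : N →ₗ[S] N) (hφψ : ∀ m, g (φ m) = ψ (g m)) :
    ψ.charpoly = φ.charpoly.map f := by
  rw [← LinearMap.charpoly_toMatrix ψ b', ← LinearMap.charpoly_toMatrix φ b,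
    toMatrix_eq_map_of_semilinear f b b' g hg hb φ ψ hφψ, Matrix.charpoly_map]

omit [Module.Free S N] [Module.Finite S N] [Fintype ι] [DecidableEq ι] in
/-- The reverse of a monic polynomial commutes with a ring map to a nontrivial ring. [folklore] -/
theorem reverse_map_of_monic [Nontrivial S] {P : R[X]} (hP : P.Monic) :
    (P.map f).reverse = P.reverse.map f := by
  rw [Polynomial.reverse, Polynomial.reverse, hP.natDegree_map f, Polynomial.reflect_map]

omit [Module.Free R M] [Module.Finite R M] [Module.Free S N] [Module.Finite S N] [Fintype ι]
  [DecidableEq ι] in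
/-- **Evaluation of a polynomial in an operator under a semilinear map**:
`g (Q(T) m) = (Q reduced by f)(T′) (g m)` when `g ∘ T = T′ ∘ g`. [folklore] -/
theorem apply_aeval_eq_aeval_map (g : M →+ N) (hg : ∀ (r : R) (m : M), g (r • m) = f r • g m)
    (T : Module.End R M) (T' : Module.End S N) (hT : ∀ m, g (T m) = T' (g m)) (Q : R[X]) (m : M) :
    g (aeval T Q m) = aeval T' (Q.map f) (g m) := by
  induction Q using Polynomial.induction_on' generalizing m with
  | add p q hp hq => rw [map_add, LinearMap.add_apply, map_add, hp, hq, Polynomial.map_add,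
      map_add, LinearMap.add_apply]
  | monomial n a =>
    rw [Polynomial.map_monomial, aeval_monomial, aeval_monomial, Module.End.mul_apply,
      Module.End.mul_apply, Module.algebraMap_end_apply, Module.algebraMap_end_apply, hg]
    congr 1
    induction n generalizing m with
    | zero => rw [pow_zero, pow_zero, Module.End.one_apply, Module.End.one_apply]
    | succ n ih => rw [pow_succ, pow_succ, Module.End.mul_apply, Module.End.mul_apply, ih, hT]

omit [Module.Free R M] [Module.Finite R M] [Module.Free S N] [Module.Finite S N] [Fintype ι]
  [DecidableEq ι] in
/-- **Evaluation of a reduced polynomial under an "inclusion"** `i : N → M` on which the `R`-action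
factors through `f` (`r • i n = i (f r • n)`): `Q(T) (i n) = i ((Q reduced by f)(T′) n)` when
`T ∘ i = i ∘ T′`. [folklore] -/
theorem aeval_apply_incl_eq (i : N →+ M) (hi : ∀ (r : R) (n : N), r • i n = i (f r • n))
    (T : Module.End R M) (T' : Module.End S N) (hT : ∀ n, T (i n) = i (T' n)) (Q : R[X]) (n : N) :
    aeval T Q (i n) = i (aeval T' (Q.map f) n) := by
  induction Q using Polynomial.induction_on' generalizing n with
  | add p q hp hq => rw [map_add, LinearMap.add_apply, hp, hq, Polynomial.map_add, map_add,
      LinearMap.add_apply, map_add]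
  | monomial k a =>
    rw [Polynomial.map_monomial, aeval_monomial, aeval_monomial, Module.End.mul_apply,
      Module.End.mul_apply, Module.algebraMap_end_apply, Module.algebraMap_end_apply]
    have hpow : ∀ n, (T ^ k) (i n) = i ((T' ^ k) n) := by
      intro n
      induction k generalizing n with
      | zero => rw [pow_zero, pow_zero, Module.End.one_apply, Module.End.one_apply]
      | succ k ih => rw [pow_succ, pow_succ, Module.End.mul_apply, Module.End.mul_apply, hT, ih]
    rw [hpow, hi]

end CharpolyMap

section Operator

variable {F : Type u} [Field F] {M : Type u} [AddCommGroup M] [TopologicalSpace M] [DiscreteTopology M]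
  {N : Type u} [AddCommGroup N] [TopologicalSpace N] [DiscreteTopology N]
variable (ρM : DiscreteGaloisModule F M) (ρN : DiscreteGaloisModule F N)
variable {N₁ N₂ : ℕ} [Module (ZMod N₂) M] [Module.Free (ZMod N₂) M] [Module.Finite (ZMod N₂) M]
  [Module (ZMod N₁) N] [Module.Free (ZMod N₁) N] [Module.Finite (ZMod N₁) N]
variable (hdvd : N₁ ∣ N₂)

/-- **`P_N = P_M mod N₁`, `Q_N = Q_M mod N₁`** for Rubin's `P(x) = det(1 − φx)` and `Q = P/(x − 1)`
(tree `comparisonP`, `comparisonQ`), when `g : M → N` is additive, equivariant,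
`ℤ/N₂ → ℤ/N₁`-semilinear and carries a `ℤ/N₂`-basis of `M` to a `ℤ/N₁`-basis of `N` (for
`E[p²] ↠ E[p]`: the Frobenius polynomials of the truncations of `T_pE` are the reductions of one
another). [cite: Rubin2011, Def. 1.9.6 (p. 14)] [cite: Kim2022StructureSelmer, §2.1.2] -/
theorem comparisonQ_eq_map [Fact (1 < N₁)] {ι : Type*} [Fintype ι] [DecidableEq ι]
    (b : Basis ι (ZMod N₂) M) (b' : Basis ι (ZMod N₁) N) (g : M →+ N)
    (hg : ∀ (r : ZMod N₂) (m : M), g (r • m) = ZMod.castHom hdvd (ZMod N₁) r • g m)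
    (hb : ∀ i, g (b i) = b' i) (φ : absoluteGaloisGroup F) (hφ : ∀ m, g (ρM φ m) = ρN φ (g m)) :
    ρN.comparisonP N₁ φ = (ρM.comparisonP N₂ φ).map (ZMod.castHom hdvd (ZMod N₁)) ∧
      ρN.comparisonQ N₁ φ = (ρM.comparisonQ N₂ φ).map (ZMod.castHom hdvd (ZMod N₁)) := by
  haveI : Nontrivial (ZMod N₁) := ZMod.nontrivial N₁
  set f := ZMod.castHom hdvd (ZMod N₁) with hf
  have hchar : (ρN.zmodEnd N₁ φ).charpoly = (ρM.zmodEnd N₂ φ).charpoly.map f :=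
    charpoly_eq_map_of_semilinear f b b' g hg hb _ _ (fun m => by
      rw [zmodEnd_apply, zmodEnd_apply, hφ])
  have hP : ρN.comparisonP N₁ φ = (ρM.comparisonP N₂ φ).map f := by
    rw [comparisonP_def, comparisonP_def, hchar,
      reverse_map_of_monic f (LinearMap.charpoly_monic _)]
  refine ⟨hP, ?_⟩
  have hXC : (X - C (1 : ZMod N₂)).map f = X - C 1 := by
    rw [Polynomial.map_sub, Polynomial.map_X, Polynomial.map_C, RingHom.map_one]
  rw [comparisonQ, comparisonQ, hP, Polynomial.map_divByMonic f (monic_X_sub_C 1), hXC]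

/-- **`g ∘ Q_M(φ⁻¹) = Q_N(φ⁻¹) ∘ g`** (the comparison OPERATORS of Rubin Def. 1.9.6 under the
reduction `g`). [cite: Rubin2011, Def. 1.9.6 (p. 14)] -/
theorem apply_comparisonOp_eq [Fact (1 < N₁)] {ι : Type*} [Fintype ι] [DecidableEq ι]
    (b : Basis ι (ZMod N₂) M) (b' : Basis ι (ZMod N₁) N) (g : M →+ N)
    (hg : ∀ (r : ZMod N₂) (m : M), g (r • m) = ZMod.castHom hdvd (ZMod N₁) r • g m)
    (hb : ∀ i, g (b i) = b' i) (hρ : ∀ (σ : absoluteGaloisGroup F) (m : M), g (ρM σ m) = ρN σ (g m))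
    (φ : absoluteGaloisGroup F) (m : M) :
    g (ρM.comparisonOp N₂ φ m) = ρN.comparisonOp N₁ φ (g m) := by
  rw [comparisonOp_def, comparisonOp_def,
    (comparisonQ_eq_map ρM ρN hdvd b b' g hg hb φ (hρ φ)).2]
  exact apply_aeval_eq_aeval_map _ g hg _ _ (fun m => by rw [zmodEnd_apply, zmodEnd_apply, hρ]) _ m

/-- **`Q_M(φ⁻¹) ∘ i = i ∘ Q_N(φ⁻¹)`** for an equivariant "inclusion" `i : N → M` on which the
`ℤ/N₂`-action factors through `ℤ/N₁` (for `E[p] ↪ E[p²]`), given the polynomial identity of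
`comparisonQ_eq_map` (obtained from a reduction `g`). [cite: Rubin2011, Def. 1.9.6 (p. 14)] -/
theorem comparisonOp_apply_eq_of_incl
    (hQ : ∀ φ : absoluteGaloisGroup F,
      ρN.comparisonQ N₁ φ = (ρM.comparisonQ N₂ φ).map (ZMod.castHom hdvd (ZMod N₁)))
    (i : N →+ M) (hi : ∀ (r : ZMod N₂) (n : N), r • i n = i (ZMod.castHom hdvd (ZMod N₁) r • n))
    (hρ : ∀ (σ : absoluteGaloisGroup F) (n : N), ρM σ (i n) = i (ρN σ n))
    (φ : absoluteGaloisGroup F) (n : N) :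
    ρM.comparisonOp N₂ φ (i n) = i (ρN.comparisonOp N₁ φ n) := by
  rw [comparisonOp_def, comparisonOp_def, hQ φ]
  exact aeval_apply_incl_eq _ i hi _ _ (fun n => by rw [zmodEnd_apply, zmodEnd_apply, hρ]) _ n

end Operator



/-! ### §2b Any additive map is `ℤ/N₂ → ℤ/N₁`-semilinear -/

section Semilinear

variable {N₁ N₂ : ℕ} [NeZero N₂] (hdvd : N₁ ∣ N₂)
variable {A B : Type*} [AddCommGroup A] [AddCommGroup B] [Module (ZMod N₂) A] [Module (ZMod N₁) B]

/-- **An additive map from a `ℤ/N₂`-module to a `ℤ/N₁`-module (`N₁ ∣ N₂`) is semilinear over the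
reduction `ℤ/N₂ → ℤ/N₁`**: both scalar actions are the `ℤ`-action (`r • a = r.val • a`). [folklore] -/
theorem map_zmod_smul_eq_castHom_smul {F : Type*} [FunLike F A B] [AddMonoidHomClass F A B] (g : F)
    (r : ZMod N₂) (a : A) : g (r • a) = ZMod.castHom hdvd (ZMod N₁) r • g a := by
  rw [← ZMod.natCast_zmod_val r, Nat.cast_smul_eq_nsmul, map_nsmul, map_natCast,
    Nat.cast_smul_eq_nsmul]

/-- **On the image of an additive map from a `ℤ/N₁`-module into a `ℤ/N₂`-module the `ℤ/N₂`-action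
factors through `ℤ/N₁`**: `r • i b = i (r̄ • b)`. [folklore] -/
theorem zmod_smul_map_eq_map_castHom_smul {F : Type*} [FunLike F B A] [AddMonoidHomClass F B A] (i : F)
    (r : ZMod N₂) (b : B) : r • i b = i (ZMod.castHom hdvd (ZMod N₁) r • b) := by
  rw [← ZMod.natCast_zmod_val r, Nat.cast_smul_eq_nsmul, map_natCast, Nat.cast_smul_eq_nsmul,
    map_nsmul]

end Semilinear

end Summit.BirchSwinnertonDyer.Rank1Residual.GaloisImage.KSDevissage

end
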